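import Summits.CriticalPhenomena.PercolationContinuityZ3.Theorems.PercNearOneGluingNoHeavyLowerTailFKCSHPeel
import Summits.CriticalPhenomena.PercolationContinuityZ3.Theorems.PercNearOneGluingNoHeavyLowerTailFKUpperChain
import Summits.CriticalPhenomena.PercolationContinuityZ3.Theorems.PercNearOneGluingNoHeavyLowerTailCSHTheoremOne
import Literature.Probability.LatticeModels.RandomClusterEdgeWeightsContinuity
import Literature.Probability.LatticeModels.ProdBernoulliWeightContinuity
import HarnessLib

/-!
# FK sub-lane: `CSHFK q ⟹ AdditiveGluingFK q` for every `q ≥ 1` — the top of the FK finite leg in Lean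
# ((S5) under `μ` at every observer position, additive gluing under any fully supported CPA measure satisfying CSH, closure over
# degenerate random-cluster parameters)

Support file (`--supports stmt-CriticalPhenomena-4575`), FK sub-lane `prim-bschramm-fk-1` (gen 2) of the post-continuity programme;
builds on p205010 (kernel theorem, internal audit signed; external expert review pending).  No definitions, no named facts, no sorries;
standard axioms.

* `FK.surplusμ_nonneg_of_mem` — an observer inside the relay set has `Sur_o(T) ≥ 0` (any probability measure; no min-form needed);
* `FK.surplusTransferμ_of_s5dMarginμ`, `FK.surplusTransferμ_of_cshFor` — (S5) under `μ` in fk-2's `hS5` shape, every observer position,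
  from CSH under `μ` (hp-8's `CSH.surplusTransfer_nondegenerate_of_s5dMargin` for a fully supported probability measure, with the peeling
  `FK.s5dMarginμ_nonneg_of_cshFor`);
* `FK.additiveGluingUnder_of_cshFor` — **for EVERY probability measure `μ` on `BondConfig (Fin n)` with (i) full support, (ii) one-cluster
  conditional positive association given `{s ↮ X}` (vdBHK Thm. 1.3 shape) and (iii) CSH for all data: additive gluing under `μ`** —
  CSH_μ ⟹ (S5)_μ (this lane) ⟹ (GEN)_μ ⟹ (AG-loc)_μ ⟹ gluing (fk-2's `FK.additiveGluingUnder_of_surplusTransfer`).  This is the precise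
  "class of measures" statement the finite leg supports;
* `FK.additiveGluingUnder_rcMeasureW_of_cshFK` — the random-cluster case at non-degenerate parameters (`q ≥ 1`; CPA =
  `BHK2006_clusterConditionalPositiveAssociation_rc`, full support = finite energy `rcMeasureW_real_pos_of_nonempty`);
* `FK.additiveGluingFK_of_forall_nondegenerate` — closure over degenerate parameters by continuity in `𝐩` (`rcMeasureW_real_continuous`,
  `weights_le_of_forall_pos_lt_one`, a continuous threshold correction);
* **`FK.additiveGluingFK_of_cshFK (hq : 1 ≤ q) : FK.CSHFK q → FK.AdditiveGluingFK q`** and `FK.nearOneGluingFK_of_cshFK`;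
* a `q = 1` sanity `example` re-deriving the crux `AdditiveGluing` from the tree theorem `CSH.cshAll` through this chain.
NOTHING is asserted about `CSHFK q` for `q ≠ 1`: it is the remaining obligation of the FK lane (level zero MDL(X)_FK = fk-2's
`FK.markerDominanceAvoid_rc`; higher levels need Lemma U_FK and (Htw)_FK).
[cite: KozmaNitzan2024, Conj. 1 (p. 3), Conj. 3 (p. 15), Conj. 4 (p. 32)] [cite: VandenbergHaggstromKahn2005, Thm. 1.3 (p. 6), Thm. 2.1 (p. 9), §2.1 (pp. 9–13)]
[cite: Grimmett2006, §1.4 eq. (1.20) (p. 15); Thm. (3.1) eq. (3.4); Thm. (3.8); §4.5]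
-/

noncomputable section

namespace Summit.CriticalPhenomena.PercolationContinuityZ3.Theorems

open MeasureTheory Set Literature.Probability.LatticeModels Literature.Probability.Percolation
open scoped Classical

namespace FK

open KNPreFKG

variable {n : ℕ}


/-- **An observer inside the relay set has nonnegative surplus, under any probability measure**: for `o ∈ T` and an injective
`m_μ`-compatible rank, `Sur_o(T) ≥ 0` — the first-in-rank relay of `o`'s cluster has rank `≤ r o`, hence mean `≤ m_o`, and the patterns
partition `{o ↔ T} = everything`. (`CSH.surplus_nonneg_of_mem` under `μ`, proved without the min-form.) [cite: KozmaNitzan2024, Conj. 4 (p. 32)] -/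
theorem surplusμ_nonneg_of_mem (μ : Measure (BondConfig (Fin n))) [IsProbabilityMeasure μ] (T : Finset (Fin n)) (r : Fin n → ℕ)
    (F : Set (Fin n) → ℝ) (o : Fin n) (ho : o ∈ T) (hr : Set.InjOn r ↑T)
    (hcompat : ∀ b ∈ T, ∀ b' ∈ T, r b < r b' → ∫ ω, F (openCluster ω b) ∂μ ≤ ∫ ω, F (openCluster ω b') ∂μ) :
    0 ≤ surplusμ μ T r F o := by
  classical
  have hmeas : ∀ S : Set (BondConfig (Fin n)), MeasurableSet S := fun _ => MeasurableSet.of_discrete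
  have hn := fun (S : Set (BondConfig (Fin n))) => (measureReal_nonneg : 0 ≤ μ.real S)
  set m : Fin n → ℝ := fun b => ∫ η, F (openCluster η b) ∂μ with hm
  -- `{o ↔ T}` is everything since `o ∈ T`
  have hU : (⋃ a ∈ T, (openConn o a : Set (BondConfig (Fin n)))) = univ := by
    refine eq_univ_of_forall fun ω => mem_iUnion₂.2 ⟨o, ho, ?_⟩
    exact SimpleGraph.Reachable.refl _
  -- each pattern term is at most `μ(P_a) · m_o`
  have hterm : ∀ a ∈ T, μ.real (openConn o a ∩ ⋂ a' ∈ T.filter (fun a' => r a' < r a), (openConn o a')ᶜ : Set (BondConfig (Fin n))) *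
      m a ≤ μ.real (openConn o a ∩ ⋂ a' ∈ T.filter (fun a' => r a' < r a), (openConn o a')ᶜ : Set (BondConfig (Fin n))) * m o := by
    intro a ha
    by_cases hlt : r o < r a
    · -- `o` itself is an earlier relay reached by `o`: the pattern of `a` is empty
      have hempty : (openConn o a ∩ ⋂ a' ∈ T.filter (fun a' => r a' < r a), (openConn o a')ᶜ : Set (BondConfig (Fin n))) = ∅ := by
        refine eq_empty_of_forall_notMem fun ω hω => ?_
        have h2 := (mem_iInter₂.1 hω.2) o (Finset.mem_filter.2 ⟨ho, hlt⟩)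
        exact h2 (SimpleGraph.Reachable.refl _)
      rw [hempty, measureReal_empty, zero_mul, zero_mul]
    · refine mul_le_mul_of_nonneg_left ?_ (hn _)
      rcases (not_lt.1 hlt).lt_or_eq with h | h
      · exact hcompat a ha o ho h
      · rw [hr ha ho h]
  have hsum := sum_measureReal_firstRank_under μ T r o hr
  rw [hU, probReal_univ] at hsum
  have hle : ∑ a ∈ T, μ.real (openConn o a ∩ ⋂ a' ∈ T.filter (fun a' => r a' < r a), (openConn o a')ᶜ : Set (BondConfig (Fin n))) * m a
      ≤ m o := by
    calc _ ≤ ∑ a ∈ T, μ.real (openConn o a ∩ ⋂ a' ∈ T.filter (fun a' => r a' < r a), (openConn o a')ᶜ : Set (BondConfig (Fin n))) * m o :=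
          Finset.sum_le_sum hterm
      _ = m o := by rw [← Finset.sum_mul, hsum, one_mul]
  unfold surplusμ
  rw [hU, Measure.restrict_univ]
  simp only [hm] at hle ⊢
  linarith

/-- **(S5) under `μ` from the decoy-free (S5D) margin, every observer position** (`CSH.surplusTransfer_nondegenerate_of_s5dMargin` under a
fully supported probability measure): if `v ∉ T` and, in case `o ∉ T` and `o ≠ v`, the margin `Sur_o − p·Sur_v` is nonnegative, then
`μ(v ↮ T, o ↔ v)·Sur_v(T) ≤ μ(v ↮ T)·Sur_o(T)`. [cite: KozmaNitzan2024, Conj. 4 (p. 32)] -/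
theorem surplusTransferμ_of_s5dMarginμ (μ : Measure (BondConfig (Fin n))) [IsProbabilityMeasure μ]
    (hfull : ∀ S : Set (BondConfig (Fin n)), S.Nonempty → 0 < μ.real S)
    (T : Finset (Fin n)) (o v : Fin n) (F : Set (Fin n) → ℝ) (r : Fin n → ℕ) (hvT : v ∉ T) (hr : Set.InjOn r ↑T)
    (hcompat : ∀ b ∈ T, ∀ b' ∈ T, r b < r b' → ∫ ω, F (openCluster ω b) ∂μ ≤ ∫ ω, F (openCluster ω b') ∂μ)
    (hmarg : o ∉ T → o ≠ v → 0 ≤ s5dMarginμ μ T r [] o v F) :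
    μ.real ({ω : BondConfig (Fin n) | ∀ a ∈ T, ¬ (openGraph ω).Reachable v a} ∩ openConn o v) * surplusμ μ T r F v ≤
      μ.real {ω : BondConfig (Fin n) | ∀ a ∈ T, ¬ (openGraph ω).Reachable v a} * surplusμ μ T r F o := by
  by_cases hov : o = v
  · subst hov
    have hOO : (openConn o o : Set (BondConfig (Fin n))) = univ := eq_univ_of_forall fun ω => SimpleGraph.Reachable.refl _
    rw [hOO, inter_univ]
  by_cases hoT : o ∈ T
  · have hempty : ({ω : BondConfig (Fin n) | ∀ a ∈ T, ¬ (openGraph ω).Reachable v a} ∩ openConn o v) = ∅ := by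
      refine eq_empty_of_forall_notMem fun ω hω => ?_
      exact hω.1 o hoT (SimpleGraph.Reachable.symm hω.2)
    rw [hempty, measureReal_empty, zero_mul]
    exact mul_nonneg measureReal_nonneg (surplusμ_nonneg_of_mem μ T r F o hoT hr hcompat)
  · have hne : ({ω : BondConfig (Fin n) | ∀ a ∈ (↑T : Set (Fin n)), ¬ (openGraph ω).Reachable v a}).Nonempty := by
      refine ⟨∅, fun a ha hreach => ?_⟩
      rw [reachable_openGraph_empty_iff] at hreach
      exact hvT (hreach ▸ ha)
    exact hS5_of_s5dMarginμ_nil μ T r o v F (hfull _ hne) (hmarg hoT hov)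

/-- **(S5) under `μ` — fk-2's hypothesis `hS5` — from the conditioned slack hierarchy under `μ`**, for a fully supported probability
measure: all relay sets, all observer positions with `v ∉ T`, all monotone nonnegative `F`, all injective `m_μ`-compatible ranks.
(Memo Theorem 2 at `k = 0` composed with the observer-position bookkeeping.) [cite: KozmaNitzan2024, Conj. 4 (p. 32)] -/
theorem surplusTransferμ_of_cshFor (μ : Measure (BondConfig (Fin n))) [IsProbabilityMeasure μ]
    (hfull : ∀ S : Set (BondConfig (Fin n)), S.Nonempty → 0 < μ.real S)
    (hCSH : ∀ (o v x : Fin n) (Y : Finset (Fin n)) (D : List (Fin n)),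
      o ≠ v → x ∉ Y → o ≠ x → v ≠ x → o ∉ Y → v ∉ Y → D.Nodup → (∀ d ∈ D, d ≠ x ∧ d ∉ Y ∧ d ≠ o ∧ d ≠ v) →
      CSHHoldsFor μ x (↑Y : Set (Fin n)) D o v)
    (T : Finset (Fin n)) (o v : Fin n) (F : Set (Fin n) → ℝ) (r : Fin n → ℕ) (hvT : v ∉ T)
    (hF : ∀ S S' : Set (Fin n), S ⊆ S' → F S ≤ F S') (hr : Set.InjOn r ↑T)
    (hcompat : ∀ a ∈ T, ∀ a' ∈ T, r a < r a' → ∫ ω, F (openCluster ω a) ∂μ ≤ ∫ ω, F (openCluster ω a') ∂μ) :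
    μ.real ({ω : BondConfig (Fin n) | ∀ a ∈ T, ¬ (openGraph ω).Reachable v a} ∩ openConn o v) *
        ((∫ ω in (⋃ a ∈ T, openConn v a), F (openCluster ω v) ∂μ) -
          ∑ a ∈ T, μ.real (openConn v a ∩ ⋂ a' ∈ T.filter (fun a' => r a' < r a), (openConn v a')ᶜ : Set (BondConfig (Fin n))) *
            ∫ ω, F (openCluster ω a) ∂μ) ≤
      μ.real {ω : BondConfig (Fin n) | ∀ a ∈ T, ¬ (openGraph ω).Reachable v a} *
        ((∫ ω in (⋃ a ∈ T, openConn o a), F (openCluster ω o) ∂μ) -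
          ∑ a ∈ T, μ.real (openConn o a ∩ ⋂ a' ∈ T.filter (fun a' => r a' < r a), (openConn o a')ᶜ : Set (BondConfig (Fin n))) *
            ∫ ω, F (openCluster ω a) ∂μ) :=
  surplusTransferμ_of_s5dMarginμ μ hfull T o v F r hvT hr hcompat fun hoT hov =>
    s5dMarginμ_nonneg_of_cshFor μ hfull o v (fun x Y D => hCSH o v x Y D hov) T r [] F hF hr hcompat hoT hvT List.nodup_nil
      (fun _ hd => absurd hd List.not_mem_nil)

/-- **Additive gluing under `μ` from the conditioned slack hierarchy under `μ`** — for EVERY probability measure on the bond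
configurations of `Fin n` that (i) charges every nonempty event, (ii) has one-cluster conditional positive association given `{s ↮ X}`
(van den Berg–Häggström–Kahn Thm. 1.3 shape; the input of (S5) ⇒ (GEN)), and (iii) satisfies CSH for all data with distinct named
vertices: `FK.AdditiveGluingUnder μ A o b` for all `A, o, b`.  Chain: CSH_μ ⟹ (S5)_μ (`surplusTransferμ_of_cshFor`, this file) ⟹ (GEN)_μ ⟹
(AG-loc)_μ ⟹ additive gluing (fk-2's `FK.additiveGluingUnder_of_surplusTransfer`).  This is the precise "which class of measures" statement
the finite leg supports: nothing about `μ` is used beyond (i)–(iii).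
[cite: KozmaNitzan2024, Conj. 1 (p. 3), Conj. 4 (p. 32)] [cite: VandenbergHaggstromKahn2005, Thm. 1.3 (p. 6)] -/
theorem additiveGluingUnder_of_cshFor (μ : Measure (BondConfig (Fin n))) [IsProbabilityMeasure μ]
    (hfull : ∀ S : Set (BondConfig (Fin n)), S.Nonempty → 0 < μ.real S)
    (hCPA : ∀ (s : Fin n) (X : Set (Fin n)) (F G : Set (Sym2 (Fin n)) → ℝ), Monotone F → Monotone G → s ∉ X →
      (∫ ω in {ω : BondConfig (Fin n) | ∀ x ∈ X, ¬ (openGraph ω).Reachable s x}, F (openEdgeCluster ω s) ∂μ) *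
        (∫ ω in {ω : BondConfig (Fin n) | ∀ x ∈ X, ¬ (openGraph ω).Reachable s x}, G (openEdgeCluster ω s) ∂μ) ≤
      μ.real {ω : BondConfig (Fin n) | ∀ x ∈ X, ¬ (openGraph ω).Reachable s x} *
        ∫ ω in {ω : BondConfig (Fin n) | ∀ x ∈ X, ¬ (openGraph ω).Reachable s x},
          F (openEdgeCluster ω s) * G (openEdgeCluster ω s) ∂μ)
    (hCSH : ∀ (o v x : Fin n) (Y : Finset (Fin n)) (D : List (Fin n)),
      o ≠ v → x ∉ Y → o ≠ x → v ≠ x → o ∉ Y → v ∉ Y → D.Nodup → (∀ d ∈ D, d ≠ x ∧ d ∉ Y ∧ d ≠ o ∧ d ≠ v) →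
      CSHHoldsFor μ x (↑Y : Set (Fin n)) D o v)
    (A : Finset (Fin n)) (o b : Fin n) : AdditiveGluingUnder μ A o b :=
  additiveGluingUnder_of_surplusTransfer μ hCPA
    (fun T o' v F r hvT hF _ hr hcompat => surplusTransferμ_of_cshFor μ hfull hCSH T o' v F r hvT hF hr hcompat) A o b

/-! ### The random-cluster measures `φ_{w,q}`, `q ≥ 1` -/

/-- **Additive gluing under `φ_{w,q}` at NON-DEGENERATE parameters from `CSHFK q`** (`q ≥ 1`): full support is finite energy
(`rcMeasureW_real_pos_of_nonempty`), one-cluster CPA is van den Berg–Häggström–Kahn's Theorem 1.3 for the random-cluster measure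
(`BHK2006_clusterConditionalPositiveAssociation_rc`, tree, `q ≥ 1`), and CSH is the hypothesis `CSHFK q` at `w`.
[cite: VandenbergHaggstromKahn2005, Thm. 1.3 (p. 6), Thm. 2.1 (p. 9)] [cite: Grimmett2006, §1.4 eq. (1.20) (p. 15); Thm. (3.1) eq. (3.4)] -/
theorem additiveGluingUnder_rcMeasureW_of_cshFK {q : ℝ} (hq : 1 ≤ q) (hCSH : CSHFK q) (w : Sym2 (Fin n) → unitInterval)
    (hw : ∀ e, 0 < w e ∧ w e < 1) (A : Finset (Fin n)) (o b : Fin n) : AdditiveGluingUnder (rcMeasureW w q ∅) A o b := by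
  have hq0 : 0 < q := one_pos.trans_le hq
  haveI := isProbabilityMeasure_rcMeasureW w hq0 (∅ : Set (Fin n))
  exact additiveGluingUnder_of_cshFor (rcMeasureW w q ∅) (fun S hS => rcMeasureW_real_pos_of_nonempty hq0 hw ∅ hS)
    (fun s X F G hF hG _ => BHK2006_clusterConditionalPositiveAssociation_rc w hq s X F G hF hG)
    (fun o' v x Y D hov hxY hox hvx hoY hvY hD hdis => hCSH n w hw o' v x Y D hov hxY hox hvx hoY hvY hD hdis) A o b

/-- **Closure over degenerate parameters** (`0 < q`): if additive gluing holds under `φ_{w,q}` for every NON-DEGENERATE `w` (all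
`0 < w e < 1`), it holds for every `w : Sym2 (Fin n) → [0,1]` — i.e. `FK.AdditiveGluingFK q`.  Both sides of the gluing inequality are
continuous in `w` (`rcMeasureW_real_continuous`); the threshold is made continuous by replacing `t` with
`t + Σ_{a ∈ A} max(0, 1 − t − φ_w(a ↔ b)) ≥ t`, which satisfies the hypothesis at every `w` and equals `t` wherever the original
hypothesis holds; then `weights_le_of_forall_pos_lt_one` (non-degenerate weights are dense). [cite: Grimmett2006, §4.5 (Thm. (4.63)): continuity in 𝐩] -/
theorem additiveGluingFK_of_forall_nondegenerate {q : ℝ} (hq : 0 < q)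
    (h : ∀ (n : ℕ) (w : Sym2 (Fin n) → unitInterval), (∀ e, 0 < w e ∧ w e < 1) →
      ∀ (A : Finset (Fin n)) (o b : Fin n), AdditiveGluingUnder (rcMeasureW w q ∅) A o b) :
    AdditiveGluingFK q := by
  intro n w A o b t ht hAb
  classical
  -- the continuous threshold `T(w') = t + Σ_a max(0, 1 - t - φ_{w'}(a ↔ b))`
  set Tf : (Sym2 (Fin n) → unitInterval) → ℝ := fun w' =>
    t + ∑ a ∈ A, max 0 (1 - t - (rcMeasureW w' q ∅).real (openConn a b)) with hTf
  have hcont : ∀ S : Set (BondConfig (Fin n)), Continuous fun w' : Sym2 (Fin n) → unitInterval => (rcMeasureW w' q ∅).real S :=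
    fun S => rcMeasureW_real_continuous hq ∅ S
  have hTcont : Continuous Tf := by
    refine continuous_const.add (continuous_finsetSum _ fun a _ => ?_)
    exact continuous_const.max (continuous_const.sub (hcont _))
  have hle := weights_le_of_forall_pos_lt_one (ι := Sym2 (Fin n))
    (f := fun w' => (rcMeasureW w' q ∅).real (⋃ a ∈ A, openConn o a) - Tf w')
    (g := fun w' => (rcMeasureW w' q ∅).real (openConn o b)) ((hcont _).sub hTcont) (hcont _) ?_ w
  · -- at `w` the correction vanishes
    have hT : Tf w = t := by
      simp only [hTf]
      rw [Finset.sum_eq_zero fun a ha => ?_, add_zero]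
      exact max_eq_left (by linarith [hAb a ha])
    simpa only [hT] using hle
  · intro w' hw'
    have hterm0 : ∀ a ∈ A, 0 ≤ max 0 (1 - t - (rcMeasureW w' q ∅).real (openConn a b)) := fun a _ => le_max_left _ _
    have hT0 : 0 ≤ Tf w' := add_nonneg ht (Finset.sum_nonneg hterm0)
    have hTa : ∀ a ∈ A, 1 - Tf w' ≤ (rcMeasureW w' q ∅).real (openConn a b) := by
      intro a ha
      have h1 : max 0 (1 - t - (rcMeasureW w' q ∅).real (openConn a b)) ≤
          ∑ a ∈ A, max 0 (1 - t - (rcMeasureW w' q ∅).real (openConn a b)) := Finset.single_le_sum hterm0 ha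
      have h2 := le_max_right 0 (1 - t - (rcMeasureW w' q ∅).real (openConn a b))
      simp only [hTf]
      linarith
    exact h n w' hw' A o b (Tf w') hT0 hTa

/-- **`CSHFK q ⟹ AdditiveGluingFK q` for every `q ≥ 1`** — the TOP of the FK finite leg in Lean: the conditioned slack hierarchy for the
random-cluster measures `φ_{w,q}` (non-degenerate `w`, distinct named vertices; fk-1's `FK.CSHFK q`, the statement of memo Theorem 1 with
`φ_{w,q}` for `prodBernoulli w`) implies FK additive gluing on every finite weighted graph (`FK.AdditiveGluingFK q`, all `w ∈ [0,1]^{Sym2}`).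
Chain: CSH ⟹ (S5) by hp-8's peeling, measure-generic (`s5dMarginμ_nonneg_of_cshFor`); (S5) ⟹ (GEN) ⟹ (AG-loc) ⟹ gluing by fk-2's upper chain
with van den Berg–Häggström–Kahn's Thm. 1.3 for `φ_{w,q}` as CPA input; closure over degenerate `w` by continuity.  At `q = 1` both sides are
tree theorems (`CSH.cshAll`, `CSH.additiveGluing_holds`; builds on p205010 (kernel theorem, internal audit signed; external expert review
pending)); for `q > 1` NOTHING is asserted about `CSHFK q` here — it is the remaining obligation of the FK lane (its level zero MDL(X)_FK is
fk-2's tree theorem `FK.markerDominanceAvoid_rc`; higher levels need Lemma U_FK and (Htw)_FK).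
[cite: KozmaNitzan2024, Conj. 1 (p. 3), Conj. 4 (p. 32)] [cite: VandenbergHaggstromKahn2005, Thm. 1.3 (p. 6), Thm. 2.1 (p. 9), §2.1 (pp. 9–13)]
[cite: Grimmett2006, §1.4 eq. (1.20) (p. 15); Thm. (3.8)] -/
theorem additiveGluingFK_of_cshFK {q : ℝ} (hq : 1 ≤ q) (hCSH : CSHFK q) : AdditiveGluingFK q :=
  additiveGluingFK_of_forall_nondegenerate (one_pos.trans_le hq) fun _ w hw A o b =>
    additiveGluingUnder_rcMeasureW_of_cshFK hq hCSH w hw A o b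

/-- Hence also **`CSHFK q ⟹ NearOneGluingFK q`** (Kozma–Nitzan's Conjecture 3 for `φ_{w,q}`), `q ≥ 1`, by the measure-agnostic
`ε/2` argument `FK.nearOneGluingFK_of_additiveGluingFK`. [cite: KozmaNitzan2024, Conj. 1 ⇒ Conj. 3 (p. 15)] -/
theorem nearOneGluingFK_of_cshFK {q : ℝ} (hq : 1 ≤ q) (hCSH : CSHFK q) : NearOneGluingFK q :=
  nearOneGluingFK_of_additiveGluingFK q (additiveGluingFK_of_cshFK hq hCSH)

/-- Sanity check at `q = 1`: the chain of this file re-proves the crux `AdditiveGluing` from the tree theorem `CSH.cshAll` (memo Theorem 1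
for `prodBernoulli`), through `cshFK_one_iff` / `additiveGluingFK_one_iff` (builds on p205010 (kernel theorem, internal audit signed;
external expert review pending)). [cite: KozmaNitzan2024, Conj. 1 (p. 3)] -/
example : Summit.CriticalPhenomena.PercolationContinuityZ3.Theses.PercNearOneGluing.AdditiveGluing :=
  additiveGluingFK_one_iff.1 (additiveGluingFK_of_cshFK le_rfl (cshFK_one_iff.2 CSH.cshAll))

end FK

end Summit.CriticalPhenomena.PercolationContinuityZ3.Theorems

end
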